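import Literature.AlgebraicGeometry.Resolution.RidgeDimension
import Literature.AlgebraicGeometry.Resolution.RidgeDirectrixTame
import Literature.RingTheory.MvPolynomial.NuInvariantBaseChange
import HarnessLib

/-!
# The ridge is generated in degree one: Hironaka's edge datum of the ridge is `(1, …, 1)` exactly when the ridge
# ideal is linear, e.g. for cones defined in one tame degree (Frühbis-Krüger 2010 §2; BHM 2010 Rem. 2.8 / 3.12;
# CJS 2020 Rem. 18.29)

Topic: `Literature/AlgebraicGeometry/Resolution`. Sequel of `RidgeDimension.lean` (`ht 𝔉 = r`, `dim Rid = n − r` for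
the number `r` of generators of Hironaka's triangular basis of the ridge algebra), `RidgeDirectrixTame.lean` (for a
cone defined by forms of one degree `b` with `1, …, b` non-zero in `K`: `𝔉 = 𝒯(⟨G⟩)·S` is generated by linear forms)
and `PointBlowupRidge.lean`, whose predicate

> **`RidgeGeneratedInDegreeOne v`** — "The ridge is generated by polynomials of degree one (FK2010 §2: «In
> characteristic zero the ridge is always generated by polynomials of degree one; in positive characteristic the
> occurrence of a ridge not generated by polynomials of degree one marks a point for which the reasoning of
> characteristic zero might break down»): in Hironaka's datum, every edge exponent is `q_j = 1` (equivalently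
> `Rid = Dir` as schemes, BHM Rem. 2.8 / Rem. 3.12)."

is Frühbis-Krüger's indicator of characteristic-`p` phenomena. PROVED here, for a HOMOGENEOUS ideal `I` over a field of
exponential characteristic `p`:
* `hilb_one` — `hilb q 1 = #{j : q_j = 1}` (the degree-one part of `K[σ_1, …, σ_r]` is spanned by the linear `σ_j`);
* **`ridgeGeneratedInDegreeOne_of_eq_span`** — if the ridge ideal is generated by a space `T` of LINEAR forms,
  `𝔉 = T·S`, then every exponent of Hironaka's edge datum of the ridge is `1` and `r = dim_K T`
  (`ridgeEdgeInv_r_eq_finrank_of_eq_span`): `r = ht 𝔉 ≤ dim T ≤ dim U_1 = #{j : q_j = 1} ≤ r`;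
* **`ridgeGeneratedInDegreeOne_span_of_tame`** — for a cone defined by forms of one degree `b` with `1, …, b` non-zero
  in `K` (characteristic `0`, or `p > b`), the edge datum of its ridge is `(1, …, 1)` with `r = dim_K 𝒯(⟨G⟩)`, so
  **`ridgeDim_span_eq_directrixDim`**: `dim Rid = dim Dir = e(S/⟨G⟩)`; `…_of_lt_char`, `…_of_charZero`.

Written for the cell res-hironaka (seat res-L1-s46-pv-7, W4.6 rung (iv) «large characteristic»: in regime (iv), `p > b`,
Frühbis-Krüger's indicator never fires at the tangent cone of an ideal exponent of order `b`). AI-written; AI review is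
weaker than expert review.

## References

* A. Frühbis-Krüger, *A short note on Hauser's Kangaroo phenomena …*, J. Singul. 2 (2010), §2. [FruehbisKrueger2010]
* J. Berthomieu, P. Hivert, H. Mourtada, Contemp. Math. 521 (2010), Rem. 2.8, Rem. 3.12. [BerthomieuHivertMourtada2010]
* V. Cossart, U. Jannsen, S. Saito, LNM 2270 (2020), Remark 18.29. [CossartJannsenSaito2020]
* H. Hironaka, ms. 2017, Eq. (34) p.24 (the datum `Inv = (n, n − r, q₁, …, q_r)`; under adjudication, used as a
  definition only). [Hironaka2017]
-/

noncomputable section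

open MvPolynomial
open Literature.AlgebraicGeometry.Hironaka2017.EdgeAlgebra
open Literature.AlgebraicGeometry.Hironaka2017.EdgeHilbert
open Literature.AlgebraicGeometry.Hironaka2017.Datum
open Literature.RingTheory.MvPolynomial

namespace Literature.AlgebraicGeometry.Resolution

universe u

/-! ## The degree-one value of the Hilbert function of a weighted polynomial ring -/

section HilbOne

variable {r : ℕ}

/-- **`hilb q 1 = #{j : q_j = 1}`**: the solutions of `Σ m_i q_i = 1` with all `q_i ≥ 1` are the unit vectors `e_j`
with `q_j = 1` (the degree-one part of the algebra `U = K[σ]` of Hironaka's edge datum is spanned by its linear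
generators). [cite: Hironaka2017, Eq. (34) p.24] -/
theorem hilb_one (q : Fin r → ℕ) (hq : ∀ i, 1 ≤ q i) :
    hilb q 1 = (Finset.univ.filter fun j => q j = 1).card := by
  classical
  unfold hilb
  have hsol : sol q 1 = (Finset.univ.filter fun j => q j = 1).image fun j => (Pi.single j 1 : Fin r → ℕ) := by
    ext m
    rw [mem_sol hq, Finset.mem_image]
    constructor
    · intro hm
      -- some coordinate is nonzero
      obtain ⟨j, hj⟩ : ∃ j, m j ≠ 0 := by
        by_contra h
        push Not at h
        have : ∑ i, m i * q i = 0 := Finset.sum_eq_zero fun i _ => by rw [h i, zero_mul]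
        omega
      have hjle : m j * q j ≤ 1 := by
        rw [← hm]
        exact Finset.single_le_sum (f := fun i => m i * q i) (fun _ _ => Nat.zero_le _) (Finset.mem_univ j)
      have hmj : m j = 1 := by
        have h1 := hq j
        have : m j * q j ≠ 0 := Nat.mul_ne_zero hj (by omega)
        have hle : m j ≤ m j * q j := Nat.le_mul_of_pos_right _ (hq j)
        omega
      have hqj : q j = 1 := by
        have : m j * q j ≠ 0 := Nat.mul_ne_zero hj (by have := hq j; omega)
        rw [hmj, one_mul] at hjle
        have := hq j; omega
      refine ⟨j, Finset.mem_filter.mpr ⟨Finset.mem_univ j, hqj⟩, ?_⟩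
      -- the other coordinates vanish
      have hrest : ∑ i ∈ Finset.univ.erase j, m i * q i = 0 := by
        have h := Finset.add_sum_erase Finset.univ (fun i => m i * q i) (Finset.mem_univ j)
        rw [hm, hmj, hqj] at h
        omega
      funext i
      by_cases hij : i = j
      · subst hij; rw [Pi.single_eq_same, hmj]
      · rw [Pi.single_eq_of_ne hij]
        have h0 : m i * q i = 0 :=
          (Finset.sum_eq_zero_iff.mp hrest) i (Finset.mem_erase.mpr ⟨hij, Finset.mem_univ i⟩)
        have := hq i
        rcases Nat.mul_eq_zero.mp h0 with h | h
        · exact h.symm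
        · omega
    · rintro ⟨j, hj, rfl⟩
      rw [Finset.mem_filter] at hj
      have hs : ∑ i, (Pi.single j 1 : Fin r → ℕ) i * q i = ∑ i, (if i = j then 1 else 0) * q i :=
        Finset.sum_congr rfl fun i _ => by rw [Pi.single_apply]
      rw [hs, sum_unitVec_mul, hj.2]
  rw [hsol, Finset.card_image_of_injective]
  intro j j' h
  by_contra hne
  have h1 : (Pi.single j 1 : Fin r → ℕ) j = (Pi.single j' 1 : Fin r → ℕ) j := congrFun h j
  rw [Pi.single_eq_same, Pi.single_eq_of_ne hne] at h1
  exact one_ne_zero h1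

end HilbOne

/-! ## Linear ridge ideal ⇒ edge datum `(1, …, 1)` -/

section Linear

variable {K : Type u} [Field K] {n : ℕ} (p : ℕ) [ExpChar K p] {I : Ideal (MvPolynomial (Fin n) K)}

omit [ExpChar K p] in
/-- Linear forms of the ridge ideal are additive forms of the ridge algebra (`ridgeForm` with exponent `p^0 = 1`).
[cite: BerthomieuHivertMourtada2010, Def. 1.2] -/
theorem mem_ridgeAlgebra_of_isHomogeneous_one {t : MvPolynomial (Fin n) K} (ht : t ∈ ridgeIdeal I)
    (ht1 : t.IsHomogeneous 1) : t ∈ ridgeAlgebra p I := by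
  have hrange : t ∈ LinearMap.range (linForm (K := K) (n := n)) := by rw [range_linForm]; exact ht1
  obtain ⟨v, rfl⟩ := hrange
  have heq : linForm v = ∑ k, C (v k) * (X k : MvPolynomial (Fin n) K) ^ p ^ 0 := by
    rw [linForm_apply]
    exact Finset.sum_congr rfl fun k _ => by rw [pow_zero, pow_one, smul_eq_C_mul]
  have hmem : (∑ k, C (v k) * (X k : MvPolynomial (Fin n) K) ^ p ^ 0) ∈ ridgeIdeal I := heq ▸ ht
  rw [heq]
  exact Algebra.subset_adjoin ⟨⟨(v, 0), hmem⟩, rfl⟩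

/-- **If the ridge ideal is generated by a space `T` of linear forms, then `r = ht 𝔉 ≤ dim T ≤ #{j : q_j = 1}`**, so
all exponents of a triangular presentation of the ridge algebra are `1` and `r = dim T`. [cite: CossartJannsenSaito2020, Remark 18.29] -/
theorem card_filter_q_eq_one_eq_r_of_eq_span (hI : ∀ f ∈ I, ∀ d : ℕ, homogeneousComponent d f ∈ I)
    (P : TriangularPresentation p (ridgeAlgebra p I)) {T : Submodule K (MvPolynomial (Fin n) K)}
    (hT : T ≤ homogeneousSubmodule (Fin n) K 1) (h𝔉 : ridgeIdeal I = Ideal.span (T : Set (MvPolynomial (Fin n) K))) :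
    (Finset.univ.filter fun j => P.q j = 1).card = P.r ∧ Module.finrank K T = P.r := by
  classical
  haveI : FiniteDimensional K T := Submodule.finiteDimensional_of_le hT
  -- `r = ht 𝔉 ≤ dim T`
  have h1 : P.r ≤ Module.finrank K T := by
    have h := height_span_le_finrank T hT
    rw [← h𝔉, height_ridgeIdeal_eq hI P] at h
    exact_mod_cast h
  -- `dim T ≤ dim U_1 = hilb q 1 = #{j : q_j = 1}`
  have h2 : Module.finrank K T ≤ (Finset.univ.filter fun j => P.q j = 1).card := by
    rw [← hilb_one P.q P.one_le_q, ← P.hilbFun_eq 1, hilbFun]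
    refine Submodule.finrank_mono (le_inf (fun t ht => ?_) hT)
    have ht𝔉 : t ∈ ridgeIdeal I := by rw [h𝔉]; exact Ideal.subset_span ht
    exact mem_ridgeAlgebra_of_isHomogeneous_one p ht𝔉 ((mem_homogeneousSubmodule _ _).mp (hT ht))
  -- `#{j : q_j = 1} ≤ r`
  have h3 : (Finset.univ.filter fun j => P.q j = 1).card ≤ P.r := by
    calc (Finset.univ.filter fun j => P.q j = 1).card ≤ (Finset.univ : Finset (Fin P.r)).card :=
          Finset.card_filter_le _ _
      _ = P.r := by simp
  exact ⟨by omega, by omega⟩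

/-- **A linear ridge ideal has edge datum `(1, …, 1)`**: if `𝔉 = T·S` for a space `T` of linear forms then
`RidgeGeneratedInDegreeOne (ridgeEdgeInv p I)` — Frühbis-Krüger's indicator of characteristic-`p` behaviour does not
fire. [cite: FruehbisKrueger2010, §2] [cite: BerthomieuHivertMourtada2010, Rem. 2.8] -/
theorem ridgeGeneratedInDegreeOne_of_eq_span (hI : ∀ f ∈ I, ∀ d : ℕ, homogeneousComponent d f ∈ I)
    {T : Submodule K (MvPolynomial (Fin n) K)} (hT : T ≤ homogeneousSubmodule (Fin n) K 1)
    (h𝔉 : ridgeIdeal I = Ideal.span (T : Set (MvPolynomial (Fin n) K))) :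
    RidgeGeneratedInDegreeOne (ridgeEdgeInv p I) := by
  classical
  obtain ⟨P⟩ := nonempty_triangularPresentation p (ridgeAlgebra p I) (isGradedSubalgebra_ridgeAlgebra p I)
    (isDiffStable_ridgeAlgebra p I)
  have hcard := (card_filter_q_eq_one_eq_r_of_eq_span p hI P hT h𝔉).1
  -- all exponents are `1`
  have hall : ∀ j, P.q j = 1 := by
    have hfilt : (Finset.univ.filter fun j => P.q j = 1) = Finset.univ :=
      Finset.eq_univ_of_card _ (by rw [hcard, Fintype.card_fin])
    intro j
    have := Finset.mem_univ j
    rw [← hfilt, Finset.mem_filter] at this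
    exact this.2
  rw [ridgeEdgeInv, edgeInvK_eq_toEdgeInv _ _ P]
  intro x hx
  change x ∈ List.ofFn P.q at hx
  obtain ⟨j, rfl⟩ := List.mem_ofFn.mp hx
  exact hall j

/-- With a linear ridge ideal `𝔉 = T·S`: **`r = dim_K T`**. [cite: CossartJannsenSaito2020, Remark 18.29] -/
theorem ridgeEdgeInv_r_eq_finrank_of_eq_span (hI : ∀ f ∈ I, ∀ d : ℕ, homogeneousComponent d f ∈ I)
    {T : Submodule K (MvPolynomial (Fin n) K)} (hT : T ≤ homogeneousSubmodule (Fin n) K 1)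
    (h𝔉 : ridgeIdeal I = Ideal.span (T : Set (MvPolynomial (Fin n) K))) :
    (ridgeEdgeInv p I).r = Module.finrank K T := by
  obtain ⟨P⟩ := nonempty_triangularPresentation p (ridgeAlgebra p I) (isGradedSubalgebra_ridgeAlgebra p I)
    (isDiffStable_ridgeAlgebra p I)
  have hr : (ridgeEdgeInv p I).r = P.r := by
    rw [ridgeEdgeInv, edgeInvK_eq_toEdgeInv _ _ P, EdgeInv.r]
    exact P.length_qList
  rw [hr, (card_filter_q_eq_one_eq_r_of_eq_span p hI P hT h𝔉).2]

end Linear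

/-! ## Cones defined in one tame degree -/

section Tame

variable {K : Type u} [Field K] {n : ℕ} (p : ℕ) [ExpChar K p] {G : Set (MvPolynomial (Fin n) K)} {b : ℕ}

/-- **In tame degree the edge datum of the ridge of a cone defined in one degree is `(1, …, 1)`**: for a set `G` of
forms of degree `b` with `1, …, b` non-zero in `K`, `RidgeGeneratedInDegreeOne (ridgeEdgeInv p ⟨G⟩)`.
[cite: FruehbisKrueger2010, §2] [cite: BerthomieuHivertMourtada2010, Rem. 3.12] -/
theorem ridgeGeneratedInDegreeOne_span_of_tame (hG : ∀ g ∈ G, g.IsHomogeneous b)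
    (hchar : ∀ m : ℕ, 1 ≤ m → m ≤ b → (m : K) ≠ 0) :
    RidgeGeneratedInDegreeOne (ridgeEdgeInv p (Ideal.span G)) :=
  ridgeGeneratedInDegreeOne_of_eq_span p (isHomogeneousIdeal_span_of_isHomogeneous fun g hg => ⟨b, hG g hg⟩)
    (directrixSpace_le_one _) (ridgeIdeal_span_eq_span_directrixSpace hG hchar)

/-- **In tame degree `r = dim_K 𝒯(⟨G⟩)`**: the number of exponents of the edge datum of the ridge is the codimension of
the directrix. [cite: CossartJannsenSaito2020, Remark 18.29] -/
theorem ridgeEdgeInv_r_span_eq_finrank_directrixSpace (hG : ∀ g ∈ G, g.IsHomogeneous b)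
    (hchar : ∀ m : ℕ, 1 ≤ m → m ≤ b → (m : K) ≠ 0) :
    (ridgeEdgeInv p (Ideal.span G)).r = Module.finrank K (directrixSpace (Ideal.span G)) :=
  ridgeEdgeInv_r_eq_finrank_of_eq_span p (isHomogeneousIdeal_span_of_isHomogeneous fun g hg => ⟨b, hG g hg⟩)
    (directrixSpace_le_one _) (ridgeIdeal_span_eq_span_directrixSpace hG hchar)

include p in
/-- **`dim Rid = dim Dir` numerically for a cone defined in one tame degree**: `ridgeDim ⟨G⟩ = directrixDim ⟨G⟩`
(`= e(S/⟨G⟩)`; CJS Rem. 18.29's two secondary invariants agree). [cite: CossartJannsenSaito2020, Remark 18.29] -/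
theorem ridgeDim_span_eq_directrixDim_of_expChar (hG : ∀ g ∈ G, g.IsHomogeneous b)
    (hchar : ∀ m : ℕ, 1 ≤ m → m ≤ b → (m : K) ≠ 0) :
    ridgeDim (Ideal.span G) = directrixDim (Ideal.span G) := by
  rw [ridgeDim_eq_sub_ridgeEdgeInv_r p (Ideal.span G)
    (isHomogeneousIdeal_span_of_isHomogeneous fun g hg => ⟨b, hG g hg⟩),
    ridgeEdgeInv_r_span_eq_finrank_directrixSpace p hG hchar, directrixDim]

/-- **Characteristic `p > b`** (`[Fact p.Prime] [CharP K p]`): the edge datum of the ridge of a cone defined by forms of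
degree `b < p` is `(1, …, 1)`. [cite: FruehbisKrueger2010, §2] -/
theorem ridgeGeneratedInDegreeOne_span_of_lt_char [Fact p.Prime] [CharP K p] (hG : ∀ g ∈ G, g.IsHomogeneous b)
    (hbp : b < p) : RidgeGeneratedInDegreeOne (ridgeEdgeInv p (Ideal.span G)) := by
  refine ridgeGeneratedInDegreeOne_span_of_tame p hG fun m h1 hm => ?_
  rw [Ne, CharP.cast_eq_zero_iff K p m]
  exact fun hdvd => absurd (Nat.le_of_dvd (by omega) hdvd) (by omega)

end Tame

/-- **`dim Rid = dim Dir` for a cone defined in one tame degree**, over any field (its exponential characteristic is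
not named). [cite: CossartJannsenSaito2020, Remark 18.29] -/
theorem ridgeDim_span_eq_directrixDim {K : Type u} [Field K] {n : ℕ} {G : Set (MvPolynomial (Fin n) K)} {b : ℕ}
    (hG : ∀ g ∈ G, g.IsHomogeneous b) (hchar : ∀ m : ℕ, 1 ≤ m → m ≤ b → (m : K) ≠ 0) :
    ridgeDim (Ideal.span G) = directrixDim (Ideal.span G) := by
  obtain ⟨p, _⟩ := ExpChar.exists K
  exact ridgeDim_span_eq_directrixDim_of_expChar p hG hchar

/-- **Characteristic `0`**: the edge datum of the ridge of every cone defined by forms of one degree is `(1, …, 1)`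
(FK: «in characteristic zero the ridge is always generated by polynomials of degree one»). [cite: FruehbisKrueger2010, §2] -/
theorem ridgeGeneratedInDegreeOne_span_of_charZero {K : Type u} [Field K] [CharZero K] {n : ℕ}
    {G : Set (MvPolynomial (Fin n) K)} {b : ℕ} (hG : ∀ g ∈ G, g.IsHomogeneous b) :
    RidgeGeneratedInDegreeOne (ridgeEdgeInv 1 (Ideal.span G)) :=
  haveI : ExpChar K 1 := ExpChar.zero
  ridgeGeneratedInDegreeOne_span_of_tame 1 hG fun m h1 _ => by exact_mod_cast (by omega : m ≠ 0)

end Literature.AlgebraicGeometry.Resolution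

end
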